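import Mathlib
import HarnessLib
import Summits.ValiantsHypothesis.ValiantsHypothesis.Theorems.KPlusLogSqLawWeakLiftingTowerGraftWronskianKFourFifthZero

/-!
# Tower graft line — CONJECTURE W AT `K = 4`: THE THREE QUOTIENTS `U₂/U₁`, `U₃/U₂`, `U₃/U₁` AT A FIFTH ZERO

Helper file for LINE (B) `Cruxes/WeakLifting/Lines/tower_graft.lean` (crux `WeakLifting` = stmt-ValiantsHypothesis-19561), continuing
`…WronskianKFourAlternating` (g10), `…WronskianKFourLevels` and `…WronskianKFourFifthZero` (g11).  NO stub is claimed.  With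
`Uₖ = v_k·u − u_k·v = Σₗ p_{lk} X^{dₗ}` (the member of the plane `span(u,v)` omitting `X^{d_k}`), on the fully alternating Plücker cell:

* `countP_posRoots_level23_le_one_of_nonneg` — for `c ≥ 0`, `U₃ − c·U₂` has signs `sgn p₀₃·(+,+,−,−)`: `≤ 1` positive root with
  multiplicity; `countP_posRoots_level31_le_one_of_nonpos` — for `c ≤ 0`, `U₃ − c·U₁` has signs `sgn p₀₃·(+,+,±,−)`: `≤ 1`;
* `wronskian_special_members23` / `…13`: `W(U₂,U₃) = p₂₃·W(u,v)`, `W(U₁,U₃) = p₁₃·W(u,v)`; `level_double_root` (generic);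
* ★ `wronskian_root_special_product23_neg`, `wronskian_root_special_product13_pos` — at a positive zero of `W(u,v)`:
  `U₂(x)U₃(x) < 0` (resp. `U₁(x)U₃(x) > 0`) or `x` is a common zero;
* ★★ `special_products_of_five_le` — WHAT A FIFTH POSITIVE ZERO FORCES (orientation `d₀ + d₃ < d₁ + d₂`): at each positive zero,
  `U₁U₂ < 0`, `U₂U₃ < 0`, `U₁U₃ > 0` STRICTLY (a common zero of two members is a double zero of `W`, excluded by the multiplicity
  budget of `…KFourFifthZero`) and `W′(x) ≠ 0`: five simple turning points of all three quotients at levels of fixed sign.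

This is the algebraic input of the lap-counting calculus in the memo `evidence-g11-conjectureW-K4-levels.md` on the item (which pins
the lap type of a counterexample but does NOT exclude it; Conjecture W at `K = 4` for arcs remains OPEN).  HONEST FRAMING: nothing on
S4/S4f/S5/S5ᴸ, TowerB, `WeakLifting`, Conjecture B, `MatrixDescartes` (18050), `VP ≠ VNP`.  Def-free.  Seat: prover
leafhand-val-kpluslogsqlaw-1 g11, `--supports stmt-ValiantsHypothesis-19561 --as helper`.
[folklore: Descartes' rule of signs with multiplicity (Mathlib); the packaging is this work]
-/

-- `Summit.ValiantsHypothesis.ValiantsHypothesis.…` repeats a component by the D-0017 layout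
-- (single-conjunct summit), which the `dupNamespace` linter flags; the name is mandated.
set_option linter.dupNamespace false
set_option autoImplicit false

namespace Summit.ValiantsHypothesis.ValiantsHypothesis.Theorems.KPlusLogSqLaw.TowerGraft

open Polynomial Finset
open scoped BigOperators Polynomial
open Summit.ValiantsHypothesis.ValiantsHypothesis.Theorems.LacunarySymmetroidMatrixDescartes.Census
  (signVariations_rsum_le_changes mul_pos_of_mul_neg_of_mul_neg mul_neg_of_mul_pos_of_mul_neg)

namespace WronskianDevelopable

/-! ## §3 The two other quotients `U₃/U₂` and `U₃/U₁` -/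

section Cell

variable (u v : Fin 4 → ℝ) (d : Fin 4 → ℕ)

/-- more sign bookkeeping on the cell: `0 < p₀₃p₁₃`, `p₀₃p₂₃ < 0`, `0 < p₀₂p₂₃`, `0 < p₁₂p₂₃`, `p₀₂p₁₂ > 0`, and `p₂₃ ≠ 0`, `p₁₃ ≠ 0`.
[this work] -/
theorem cell_signs' 
    (h1 : (u 0 * v 1 - u 1 * v 0) * (u 0 * v 2 - u 2 * v 0) < 0) (h2 : (u 0 * v 2 - u 2 * v 0) * (u 0 * v 3 - u 3 * v 0) < 0)
    (h3 : (u 0 * v 3 - u 3 * v 0) * (u 1 * v 2 - u 2 * v 1) < 0) (h4 : (u 1 * v 2 - u 2 * v 1) * (u 1 * v 3 - u 3 * v 1) < 0)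
    (h5 : (u 1 * v 3 - u 3 * v 1) * (u 2 * v 3 - u 3 * v 2) < 0) :
    0 < (u 0 * v 3 - u 3 * v 0) * (u 1 * v 3 - u 3 * v 1) ∧ (u 0 * v 3 - u 3 * v 0) * (u 2 * v 3 - u 3 * v 2) < 0 ∧
      0 < (u 0 * v 2 - u 2 * v 0) * (u 2 * v 3 - u 3 * v 2) ∧ 0 < (u 1 * v 2 - u 2 * v 1) * (u 2 * v 3 - u 3 * v 2) ∧
      0 < (u 0 * v 2 - u 2 * v 0) * (u 1 * v 2 - u 2 * v 1) ∧ (u 2 * v 3 - u 3 * v 2) ≠ 0 ∧ (u 1 * v 3 - u 3 * v 1) ≠ 0 := by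
  obtain ⟨hA, hB, hC, hne⟩ := cell_signs u v h1 h2 h3 h4 h5
  have h03_13 : 0 < (u 0 * v 3 - u 3 * v 0) * (u 1 * v 3 - u 3 * v 1) := mul_pos_of_mul_neg_of_mul_neg h3 h4
  have h03_23 : (u 0 * v 3 - u 3 * v 0) * (u 2 * v 3 - u 3 * v 2) < 0 := mul_neg_of_mul_pos_of_mul_neg h03_13 h5
  have h02_23 : 0 < (u 0 * v 2 - u 2 * v 0) * (u 2 * v 3 - u 3 * v 2) := mul_pos_of_mul_neg_of_mul_neg h2 h03_23
  have hne23 : (u 2 * v 3 - u 3 * v 2) ≠ 0 := by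
    intro h; rw [h, mul_zero] at h5; exact lt_irrefl 0 h5
  have hne13 : (u 1 * v 3 - u 3 * v 1) ≠ 0 := by
    intro h; rw [h, zero_mul] at h5; exact lt_irrefl 0 h5
  exact ⟨h03_13, h03_23, h02_23, hC, hB, hne23, hne13⟩

/-- the level member `U₃ − c·U₂` as a fewnomial. [folklore] -/
theorem level_member23_eq (c : ℝ) :
    (∑ l, C (u l * v 3 - u 3 * v l) * (X : ℝ[X]) ^ d l) - C c * (∑ l, C (u l * v 2 - u 2 * v l) * (X : ℝ[X]) ^ d l) =
      ∑ l, C ((u l * v 3 - u 3 * v l) - c * (u l * v 2 - u 2 * v l)) * (X : ℝ[X]) ^ d l := by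
  rw [Finset.mul_sum, ← Finset.sum_sub_distrib]
  refine Finset.sum_congr rfl fun l _ => ?_
  simp only [map_sub, map_mul]
  ring

/-- the level member `U₃ − c·U₁` as a fewnomial. [folklore] -/
theorem level_member31_eq (c : ℝ) :
    (∑ l, C (u l * v 3 - u 3 * v l) * (X : ℝ[X]) ^ d l) - C c * (∑ l, C (u l * v 1 - u 1 * v l) * (X : ℝ[X]) ^ d l) =
      ∑ l, C ((u l * v 3 - u 3 * v l) - c * (u l * v 1 - u 1 * v l)) * (X : ℝ[X]) ^ d l := by
  rw [Finset.mul_sum, ← Finset.sum_sub_distrib]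
  refine Finset.sum_congr rfl fun l _ => ?_
  simp only [map_sub, map_mul]
  ring

/-- Descartes with multiplicity against the weak pattern `(+,+,−,−)`. [folklore] -/
theorem countP_posRoots_fewnomial_four_le_one_ttff (w : Fin 4 → ℝ) (hd : StrictMono d)
    (h0 : 0 ≤ w 0) (h1 : 0 ≤ w 1) (h2 : w 2 ≤ 0) (h3 : w 3 ≤ 0) :
    (∑ l, C (w l) * (X : ℝ[X]) ^ d l).roots.countP (fun x => 0 < x) ≤ 1 := by
  obtain ⟨e, he, he0, he1, he2, he3⟩ := exists_strictMono_ext_four d hd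
  rw [fewnomial_four_eq_rsum w d e he0 he1 he2 he3]
  set c : ℕ → ℝ := fun t : ℕ => if t = 0 then w 0 else if t = 1 then w 1 else if t = 2 then w 2
    else if t = 3 then w 3 else 0 with hc
  refine (Polynomial.roots_countP_pos_le_signVariations _).trans ?_
  have h := signVariations_rsum_le_changes 4 e he c (fun t => decide (t < 2))
    (fun t _ htt => by
      have ht2 : t < 2 := of_decide_eq_true htt
      interval_cases t <;> simp [hc, h0, h1])
    (fun t ht htt => by
      have ht2 : ¬ t < 2 := of_decide_eq_false htt
      have ht' : t = 2 ∨ t = 3 := by omega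
      rcases ht' with rfl | rfl
      · simp [hc, h2]
      · simp [hc, h3])
  refine h.trans ?_
  simp [Finset.sum_range_succ]

/-- the same with a nonzero scale of known sign. [folklore] -/
theorem countP_posRoots_fewnomial_four_le_one_ttff_of_scale (s : ℝ) (hs : s ≠ 0) (w : Fin 4 → ℝ) (hd : StrictMono d)
    (h0 : 0 ≤ s * w 0) (h1 : 0 ≤ s * w 1) (h2 : s * w 2 ≤ 0) (h3 : s * w 3 ≤ 0) :
    (∑ l, C (w l) * (X : ℝ[X]) ^ d l).roots.countP (fun x => 0 < x) ≤ 1 := by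
  have hsc : (∑ l, C (s * w l) * (X : ℝ[X]) ^ d l).roots = (∑ l, C (w l) * (X : ℝ[X]) ^ d l).roots := by
    rw [← C_mul_fewnomial_four, roots_C_mul _ hs]
  rw [← hsc]
  exact countP_posRoots_fewnomial_four_le_one_ttff d (fun l => s * w l) hd h0 h1 h2 h3

/-- ★ **nonnegative levels of `U₃/U₂` are simple**: for `c ≥ 0`, `U₃ − c·U₂` has coefficient signs `sgn p₀₃ · (+,+,−,−)`, hence at
most one positive root with multiplicity. [this work] -/
theorem countP_posRoots_level23_le_one_of_nonneg (hd : StrictMono d)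
    (h1 : (u 0 * v 1 - u 1 * v 0) * (u 0 * v 2 - u 2 * v 0) < 0) (h2 : (u 0 * v 2 - u 2 * v 0) * (u 0 * v 3 - u 3 * v 0) < 0)
    (h3 : (u 0 * v 3 - u 3 * v 0) * (u 1 * v 2 - u 2 * v 1) < 0) (h4 : (u 1 * v 2 - u 2 * v 1) * (u 1 * v 3 - u 3 * v 1) < 0)
    (h5 : (u 1 * v 3 - u 3 * v 1) * (u 2 * v 3 - u 3 * v 2) < 0) {c : ℝ} (hc : 0 ≤ c) :
    (∑ l, C ((u l * v 3 - u 3 * v l) - c * (u l * v 2 - u 2 * v l)) * (X : ℝ[X]) ^ d l).roots.countP (fun x => 0 < x) ≤ 1 := by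
  obtain ⟨h03_13, h03_23, h02_23, h12_23, h02_12, hne23, hne13⟩ := cell_signs' u v h1 h2 h3 h4 h5
  have hne03 : (u 0 * v 3 - u 3 * v 0) ≠ 0 := by
    intro h; rw [h, zero_mul] at h03_13; exact lt_irrefl 0 h03_13
  refine countP_posRoots_fewnomial_four_le_one_ttff_of_scale d (u 0 * v 3 - u 3 * v 0) hne03 _ hd ?_ ?_ ?_ ?_
  · -- `X^{d₀}`: `p₀₃(p₀₃ − c p₀₂) = p₀₃² − c·p₀₂p₀₃ ≥ 0`
    have e : (u 0 * v 3 - u 3 * v 0) * ((u 0 * v 3 - u 3 * v 0) - c * (u 0 * v 2 - u 2 * v 0)) =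
        (u 0 * v 3 - u 3 * v 0) * (u 0 * v 3 - u 3 * v 0) - c * ((u 0 * v 2 - u 2 * v 0) * (u 0 * v 3 - u 3 * v 0)) := by ring
    rw [e]; nlinarith [mul_self_nonneg (u 0 * v 3 - u 3 * v 0), mul_nonneg hc (le_of_lt (neg_pos.mpr h2))]
  · -- `X^{d₁}`: `p₀₃(p₁₃ − c p₁₂) = p₀₃p₁₃ − c·p₀₃p₁₂ ≥ 0`
    have e : (u 0 * v 3 - u 3 * v 0) * ((u 1 * v 3 - u 3 * v 1) - c * (u 1 * v 2 - u 2 * v 1)) =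
        (u 0 * v 3 - u 3 * v 0) * (u 1 * v 3 - u 3 * v 1) - c * ((u 0 * v 3 - u 3 * v 0) * (u 1 * v 2 - u 2 * v 1)) := by ring
    rw [e]; nlinarith [mul_nonneg hc (le_of_lt (neg_pos.mpr h3))]
  · -- `X^{d₂}`: `p₀₃ · p₂₃ ≤ 0`
    have e : (u 0 * v 3 - u 3 * v 0) * ((u 2 * v 3 - u 3 * v 2) - c * (u 2 * v 2 - u 2 * v 2)) =
        (u 0 * v 3 - u 3 * v 0) * (u 2 * v 3 - u 3 * v 2) := by ring
    rw [e]; exact h03_23.le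
  · -- `X^{d₃}`: `p₀₃ · (0 − c(u₃v₂ − u₂v₃)) = c · p₀₃p₂₃ ≤ 0`
    have e : (u 0 * v 3 - u 3 * v 0) * ((u 3 * v 3 - u 3 * v 3) - c * (u 3 * v 2 - u 2 * v 3)) =
        c * ((u 0 * v 3 - u 3 * v 0) * (u 2 * v 3 - u 3 * v 2)) := by ring
    rw [e]; nlinarith [mul_nonneg hc (le_of_lt (neg_pos.mpr h03_23))]

/-- ★ **nonpositive levels of `U₃/U₁` are simple**: for `c ≤ 0`, `U₃ − c·U₁` has coefficient signs `sgn p₀₃ · (+,+,±,−)`, hence at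
most one positive root with multiplicity. [this work] -/
theorem countP_posRoots_level31_le_one_of_nonpos (hd : StrictMono d)
    (h1 : (u 0 * v 1 - u 1 * v 0) * (u 0 * v 2 - u 2 * v 0) < 0) (h2 : (u 0 * v 2 - u 2 * v 0) * (u 0 * v 3 - u 3 * v 0) < 0)
    (h3 : (u 0 * v 3 - u 3 * v 0) * (u 1 * v 2 - u 2 * v 1) < 0) (h4 : (u 1 * v 2 - u 2 * v 1) * (u 1 * v 3 - u 3 * v 1) < 0)
    (h5 : (u 1 * v 3 - u 3 * v 1) * (u 2 * v 3 - u 3 * v 2) < 0) {c : ℝ} (hc : c ≤ 0) :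
    (∑ l, C ((u l * v 3 - u 3 * v l) - c * (u l * v 1 - u 1 * v l)) * (X : ℝ[X]) ^ d l).roots.countP (fun x => 0 < x) ≤ 1 := by
  obtain ⟨h03_13, h03_23, h02_23, h12_23, h02_12, hne23, hne13⟩ := cell_signs' u v h1 h2 h3 h4 h5
  have h01_03 : 0 < (u 0 * v 1 - u 1 * v 0) * (u 0 * v 3 - u 3 * v 0) := mul_pos_of_mul_neg_of_mul_neg h1 h2
  have hne03 : (u 0 * v 3 - u 3 * v 0) ≠ 0 := by
    intro h; rw [h, zero_mul] at h03_13; exact lt_irrefl 0 h03_13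
  -- coefficients scaled by `p₀₃`
  have e0 : (u 0 * v 3 - u 3 * v 0) * ((u 0 * v 3 - u 3 * v 0) - c * (u 0 * v 1 - u 1 * v 0)) =
      (u 0 * v 3 - u 3 * v 0) * (u 0 * v 3 - u 3 * v 0) - c * ((u 0 * v 1 - u 1 * v 0) * (u 0 * v 3 - u 3 * v 0)) := by ring
  have g0 : 0 ≤ (u 0 * v 3 - u 3 * v 0) * ((u 0 * v 3 - u 3 * v 0) - c * (u 0 * v 1 - u 1 * v 0)) := by
    rw [e0]; nlinarith [mul_self_nonneg (u 0 * v 3 - u 3 * v 0), mul_nonneg (neg_nonneg.mpr hc) h01_03.le]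
  have e1 : (u 0 * v 3 - u 3 * v 0) * ((u 1 * v 3 - u 3 * v 1) - c * (u 1 * v 1 - u 1 * v 1)) =
      (u 0 * v 3 - u 3 * v 0) * (u 1 * v 3 - u 3 * v 1) := by ring
  have g1 : 0 ≤ (u 0 * v 3 - u 3 * v 0) * ((u 1 * v 3 - u 3 * v 1) - c * (u 1 * v 1 - u 1 * v 1)) := by
    rw [e1]; exact h03_13.le
  have e3 : (u 0 * v 3 - u 3 * v 0) * ((u 3 * v 3 - u 3 * v 3) - c * (u 3 * v 1 - u 1 * v 3)) =
      c * ((u 0 * v 3 - u 3 * v 0) * (u 1 * v 3 - u 3 * v 1)) := by ring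
  have g3 : (u 0 * v 3 - u 3 * v 0) * ((u 3 * v 3 - u 3 * v 3) - c * (u 3 * v 1 - u 1 * v 3)) ≤ 0 := by
    rw [e3]; exact mul_nonpos_of_nonpos_of_nonneg hc h03_13.le
  -- the `X^{d₂}` coefficient `p₂₃ + c·p₁₂` (scaled) has either sign: both weak patterns have one change
  rcases le_or_gt 0 ((u 0 * v 3 - u 3 * v 0) * ((u 2 * v 3 - u 3 * v 2) - c * (u 2 * v 1 - u 1 * v 2))) with g2 | g2
  · exact countP_posRoots_fewnomial_four_le_one_of_scale (u 0 * v 3 - u 3 * v 0) hne03 _ d hd g0 g1 g2 g3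
  · exact countP_posRoots_fewnomial_four_le_one_ttff_of_scale d (u 0 * v 3 - u 3 * v 0) hne03 _ hd g0 g1 g2.le g3

/-- `W(U₂,U₃) = p₂₃·W(u,v)` and `W(U₁,U₃) = p₁₃·W(u,v)`. [folklore] -/
theorem wronskian_special_members23 :
    wronskian (∑ l, C (u l * v 2 - u 2 * v l) * (X : ℝ[X]) ^ d l) (∑ l, C (u l * v 3 - u 3 * v l) * (X : ℝ[X]) ^ d l) =
      C (u 2 * v 3 - u 3 * v 2) * wronskian (∑ l, C (u l) * (X : ℝ[X]) ^ d l) (∑ l, C (v l) * (X : ℝ[X]) ^ d l) := by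
  rw [← special_member_eq u v d 2, ← special_member_eq u v d 3, wronskian_pencil_pencil]
  congr 2
  ring

/-- see `wronskian_special_members23`. [folklore] -/
theorem wronskian_special_members13 :
    wronskian (∑ l, C (u l * v 1 - u 1 * v l) * (X : ℝ[X]) ^ d l) (∑ l, C (u l * v 3 - u 3 * v l) * (X : ℝ[X]) ^ d l) =
      C (u 1 * v 3 - u 3 * v 1) * wronskian (∑ l, C (u l) * (X : ℝ[X]) ^ d l) (∑ l, C (v l) * (X : ℝ[X]) ^ d l) := by
  rw [← special_member_eq u v d 1, ← special_member_eq u v d 3, wronskian_pencil_pencil]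
  congr 2
  ring

/-- generic double-root step: if `W(F,G)(x) = 0` and `F(x) ≠ 0` then the member `G − c·F`, `c = G(x)/F(x)`, vanishes at `x` together
with its derivative. [folklore] -/
theorem level_double_root (F G : ℝ[X]) {x : ℝ} (hF : F.eval x ≠ 0) (hW : (wronskian F G).eval x = 0) :
    (G - C (G.eval x / F.eval x) * F).eval x = 0 ∧ (derivative (G - C (G.eval x / F.eval x) * F)).eval x = 0 := by
  rw [InflectionLaw.eval_wronskian] at hW
  refine ⟨?_, ?_⟩
  · rw [eval_sub, eval_mul, eval_C, div_mul_cancel₀ _ hF, sub_self]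
  · rw [derivative_sub, derivative_mul, derivative_C, zero_mul, zero_add, eval_sub, eval_mul, eval_C]
    have key : F.eval x * ((derivative G).eval x - G.eval x / F.eval x * (derivative F).eval x) = 0 := by
      field_simp
      linear_combination hW
    rcases mul_eq_zero.mp key with h | h
    · exact absurd h hF
    · exact h

/-- ★ **localization for the pair `(U₂,U₃)`**: at a positive zero of `W(u,v)`, `U₂(x)·U₃(x) < 0` or `x` is a common zero of `U₂, U₃`.
[this work] -/
theorem wronskian_root_special_product23_neg (hd : StrictMono d)
    (h1 : (u 0 * v 1 - u 1 * v 0) * (u 0 * v 2 - u 2 * v 0) < 0) (h2 : (u 0 * v 2 - u 2 * v 0) * (u 0 * v 3 - u 3 * v 0) < 0)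
    (h3 : (u 0 * v 3 - u 3 * v 0) * (u 1 * v 2 - u 2 * v 1) < 0) (h4 : (u 1 * v 2 - u 2 * v 1) * (u 1 * v 3 - u 3 * v 1) < 0)
    (h5 : (u 1 * v 3 - u 3 * v 1) * (u 2 * v 3 - u 3 * v 2) < 0) {x : ℝ} (hx : 0 < x)
    (hW : (wronskian (∑ l, C (u l) * (X : ℝ[X]) ^ d l) (∑ l, C (v l) * (X : ℝ[X]) ^ d l)).eval x = 0) :
    (∑ l, C (u l * v 2 - u 2 * v l) * (X : ℝ[X]) ^ d l).eval x *
        (∑ l, C (u l * v 3 - u 3 * v l) * (X : ℝ[X]) ^ d l).eval x < 0 ∨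
      ((∑ l, C (u l * v 2 - u 2 * v l) * (X : ℝ[X]) ^ d l).eval x = 0 ∧
        (∑ l, C (u l * v 3 - u 3 * v l) * (X : ℝ[X]) ^ d l).eval x = 0) := by
  obtain ⟨h03_13, h03_23, h02_23, h12_23, h02_12, hne23, hne13⟩ := cell_signs' u v h1 h2 h3 h4 h5
  set U₂ : ℝ[X] := ∑ l, C (u l * v 2 - u 2 * v l) * (X : ℝ[X]) ^ d l with hU₂
  set U₃ : ℝ[X] := ∑ l, C (u l * v 3 - u 3 * v l) * (X : ℝ[X]) ^ d l with hU₃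
  have hW23 : (wronskian U₂ U₃).eval x = 0 := by
    rw [hU₂, hU₃, wronskian_special_members23, eval_mul, eval_C, hW, mul_zero]
  by_cases hz : U₂.eval x = 0
  · right
    refine ⟨hz, ?_⟩
    have hder : (derivative U₂).eval x ≠ 0 := by
      intro hd0
      have h2le := two_le_countP_posRoots_of_double_root U₂ ?_ hx hz hd0
      · have h1le := countP_posRoots_special_two_le_one u v d hd h1 h2 h3 h4 h5
        rw [← hU₂] at h1le
        omega
      · intro h0
        have hcoeff := coeff_fewnomial_four (fun l => u l * v 2 - u 2 * v l) d hd 3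
        rw [← hU₂, h0, coeff_zero] at hcoeff
        apply hne23; linarith
    rw [InflectionLaw.eval_wronskian, hz, zero_mul, zero_sub, neg_eq_zero] at hW23
    rcases mul_eq_zero.mp hW23 with h | h
    · exact absurd h hder
    · exact h
  · left
    set c : ℝ := U₃.eval x / U₂.eval x with hc
    obtain ⟨hf0, hf1⟩ := level_double_root U₂ U₃ hz hW23
    have hlevel : U₃ - C c * U₂ = ∑ l, C ((u l * v 3 - u 3 * v l) - c * (u l * v 2 - u 2 * v l)) * (X : ℝ[X]) ^ d l := by
      rw [hU₂, hU₃]; exact level_member23_eq u v d c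
    have hfne : U₃ - C c * U₂ ≠ 0 := by
      intro h0
      have hcoeff := coeff_fewnomial_four (fun l => (u l * v 3 - u 3 * v l) - c * (u l * v 2 - u 2 * v l)) d hd 2
      rw [← hlevel, h0, coeff_zero] at hcoeff
      apply hne23
      have : (u 2 * v 3 - u 3 * v 2) - c * (u 2 * v 2 - u 2 * v 2) = u 2 * v 3 - u 3 * v 2 := by ring
      linarith [this]
    have h2le := two_le_countP_posRoots_of_double_root _ hfne hx hf0 hf1
    have hcneg : c < 0 := by
      by_contra hcnn
      have h1le := countP_posRoots_level23_le_one_of_nonneg u v d hd h1 h2 h3 h4 h5 (not_lt.mp hcnn)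
      rw [← hlevel] at h1le
      omega
    have hsq : 0 < U₂.eval x * U₂.eval x := mul_self_pos.mpr hz
    have e : U₂.eval x * U₃.eval x = c * (U₂.eval x * U₂.eval x) := by
      rw [hc]; field_simp
    rw [e]
    exact mul_neg_of_neg_of_pos hcneg hsq

/-- ★ **localization for the pair `(U₁,U₃)`**: at a positive zero of `W(u,v)`, `U₁(x)·U₃(x) > 0` or `x` is a common zero of `U₁, U₃`.
[this work] -/
theorem wronskian_root_special_product13_pos (hd : StrictMono d)
    (h1 : (u 0 * v 1 - u 1 * v 0) * (u 0 * v 2 - u 2 * v 0) < 0) (h2 : (u 0 * v 2 - u 2 * v 0) * (u 0 * v 3 - u 3 * v 0) < 0)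
    (h3 : (u 0 * v 3 - u 3 * v 0) * (u 1 * v 2 - u 2 * v 1) < 0) (h4 : (u 1 * v 2 - u 2 * v 1) * (u 1 * v 3 - u 3 * v 1) < 0)
    (h5 : (u 1 * v 3 - u 3 * v 1) * (u 2 * v 3 - u 3 * v 2) < 0) {x : ℝ} (hx : 0 < x)
    (hW : (wronskian (∑ l, C (u l) * (X : ℝ[X]) ^ d l) (∑ l, C (v l) * (X : ℝ[X]) ^ d l)).eval x = 0) :
    0 < (∑ l, C (u l * v 1 - u 1 * v l) * (X : ℝ[X]) ^ d l).eval x *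
        (∑ l, C (u l * v 3 - u 3 * v l) * (X : ℝ[X]) ^ d l).eval x ∨
      ((∑ l, C (u l * v 1 - u 1 * v l) * (X : ℝ[X]) ^ d l).eval x = 0 ∧
        (∑ l, C (u l * v 3 - u 3 * v l) * (X : ℝ[X]) ^ d l).eval x = 0) := by
  obtain ⟨hA, hB, hC, hne12⟩ := cell_signs u v h1 h2 h3 h4 h5
  obtain ⟨h03_13, h03_23, h02_23, h12_23, h02_12, hne23, hne13⟩ := cell_signs' u v h1 h2 h3 h4 h5
  set U₁ : ℝ[X] := ∑ l, C (u l * v 1 - u 1 * v l) * (X : ℝ[X]) ^ d l with hU₁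
  set U₃ : ℝ[X] := ∑ l, C (u l * v 3 - u 3 * v l) * (X : ℝ[X]) ^ d l with hU₃
  have hW13 : (wronskian U₁ U₃).eval x = 0 := by
    rw [hU₁, hU₃, wronskian_special_members13, eval_mul, eval_C, hW, mul_zero]
  by_cases hz : U₁.eval x = 0
  · right
    refine ⟨hz, ?_⟩
    have hder : (derivative U₁).eval x ≠ 0 := by
      intro hd0
      have h2le := two_le_countP_posRoots_of_double_root U₁ ?_ hx hz hd0
      · have h1le := countP_posRoots_special_one_le_one u v d hd h1 h2 h3 h4 h5
        rw [← hU₁] at h1le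
        omega
      · intro h0
        have hcoeff := coeff_fewnomial_four (fun l => u l * v 1 - u 1 * v l) d hd 2
        rw [← hU₁, h0, coeff_zero] at hcoeff
        apply hne12; linarith
    rw [InflectionLaw.eval_wronskian, hz, zero_mul, zero_sub, neg_eq_zero] at hW13
    rcases mul_eq_zero.mp hW13 with h | h
    · exact absurd h hder
    · exact h
  · left
    set c : ℝ := U₃.eval x / U₁.eval x with hc
    obtain ⟨hf0, hf1⟩ := level_double_root U₁ U₃ hz hW13
    have hlevel : U₃ - C c * U₁ = ∑ l, C ((u l * v 3 - u 3 * v l) - c * (u l * v 1 - u 1 * v l)) * (X : ℝ[X]) ^ d l := by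
      rw [hU₁, hU₃]; exact level_member31_eq u v d c
    have hfne : U₃ - C c * U₁ ≠ 0 := by
      intro h0
      have hcoeff := coeff_fewnomial_four (fun l => (u l * v 3 - u 3 * v l) - c * (u l * v 1 - u 1 * v l)) d hd 1
      rw [← hlevel, h0, coeff_zero] at hcoeff
      apply hne13
      have : (u 1 * v 3 - u 3 * v 1) - c * (u 1 * v 1 - u 1 * v 1) = u 1 * v 3 - u 3 * v 1 := by ring
      linarith [this]
    have h2le := two_le_countP_posRoots_of_double_root _ hfne hx hf0 hf1
    have hcpos : 0 < c := by
      by_contra hcnn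
      have h1le := countP_posRoots_level31_le_one_of_nonpos u v d hd h1 h2 h3 h4 h5 (not_lt.mp hcnn)
      rw [← hlevel] at h1le
      omega
    have hsq : 0 < U₁.eval x * U₁.eval x := mul_self_pos.mpr hz
    have e : U₁.eval x * U₃.eval x = c * (U₁.eval x * U₁.eval x) := by
      rw [hc]; field_simp
    rw [e]
    exact mul_pos hcpos hsq

end Cell

/-! ## §4 Summary at a fifth zero -/

/-- ★★ **WHAT A FIFTH POSITIVE ZERO FORCES** (orientation `d₀ + d₃ < d₁ + d₂`): at every positive zero `x` of `W(u,v)` —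
`U₁(x)U₂(x) < 0`, `U₂(x)U₃(x) < 0`, `0 < U₁(x)U₃(x)` (all strict: a common zero of two members would be a double zero of `W`), and
`W′(x) ≠ 0` (all five zeros are simple turning points of the three quotients). [this work] -/
theorem special_products_of_five_le (u v : Fin 4 → ℝ) (d : Fin 4 → ℕ) (hd : StrictMono d) (hA : d 0 + d 3 < d 1 + d 2)
    (h5 : 5 ≤ ((wronskian (∑ l, C (u l) * (X : ℝ[X]) ^ d l) (∑ l, C (v l) * (X : ℝ[X]) ^ d l)).roots.toFinset.filter
      (fun x => 0 < x)).card)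
    {x : ℝ} (hx : x ∈ (wronskian (∑ l, C (u l) * (X : ℝ[X]) ^ d l) (∑ l, C (v l) * (X : ℝ[X]) ^ d l)).roots.toFinset.filter
      (fun x => 0 < x)) :
    (∑ l, C (u l * v 1 - u 1 * v l) * (X : ℝ[X]) ^ d l).eval x * (∑ l, C (u l * v 2 - u 2 * v l) * (X : ℝ[X]) ^ d l).eval x < 0 ∧
    (∑ l, C (u l * v 2 - u 2 * v l) * (X : ℝ[X]) ^ d l).eval x * (∑ l, C (u l * v 3 - u 3 * v l) * (X : ℝ[X]) ^ d l).eval x < 0 ∧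
    0 < (∑ l, C (u l * v 1 - u 1 * v l) * (X : ℝ[X]) ^ d l).eval x * (∑ l, C (u l * v 3 - u 3 * v l) * (X : ℝ[X]) ^ d l).eval x ∧
    (derivative (wronskian (∑ l, C (u l) * (X : ℝ[X]) ^ d l) (∑ l, C (v l) * (X : ℝ[X]) ^ d l))).eval x ≠ 0 := by
  classical
  set W : ℝ[X] := wronskian (∑ l, C (u l) * (X : ℝ[X]) ^ d l) (∑ l, C (v l) * (X : ℝ[X]) ^ d l) with hWdef
  obtain ⟨c1, c2, c3, c4, c5⟩ := plucker_alternating_of_five_le u v d hd hA h5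
  obtain ⟨_, _, _, h12⟩ := cell_signs u v c1 c2 c3 c4 c5
  obtain ⟨_, _, _, _, _, hne23, hne13⟩ := cell_signs' u v c1 c2 c3 c4 c5
  have hW : W ≠ 0 := by
    intro h0
    have : (W.roots.toFinset.filter (fun x => 0 < x)).card = 0 := by simp [h0]
    omega
  have hx' := hx
  rw [Finset.mem_filter, Multiset.mem_toFinset] at hx'
  have hxpos : 0 < x := hx'.2
  have hWx : W.eval x = 0 := (mem_roots hW).mp hx'.1
  have hmult := rootMultiplicity_eq_one_of_five_le u v d hd hA h5 hx
  rw [← hWdef] at hmult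
  -- a common zero of two members `a·u+b·v`, `c·u+d·v` with `ad−bc ≠ 0` would be a double zero of `W`
  have nocommon : ∀ (a b c' d' : ℝ), a * d' - b * c' ≠ 0 →
      (C a * (∑ l, C (u l) * (X : ℝ[X]) ^ d l) + C b * (∑ l, C (v l) * (X : ℝ[X]) ^ d l)).eval x = 0 →
      (C c' * (∑ l, C (u l) * (X : ℝ[X]) ^ d l) + C d' * (∑ l, C (v l) * (X : ℝ[X]) ^ d l)).eval x = 0 → False := by
    intro a b c' d' hdet ha hb
    have hWab : wronskian (C a * (∑ l, C (u l) * (X : ℝ[X]) ^ d l) + C b * (∑ l, C (v l) * (X : ℝ[X]) ^ d l))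
        (C c' * (∑ l, C (u l) * (X : ℝ[X]) ^ d l) + C d' * (∑ l, C (v l) * (X : ℝ[X]) ^ d l)) = C (a * d' - b * c') * W := by
      rw [hWdef, wronskian_pencil_pencil]
    have hne : C (a * d' - b * c') * W ≠ 0 := mul_ne_zero (fun h => hdet (C_eq_zero.mp h)) hW
    have h2 := rootMultiplicity_wronskian_two_le_of_common_zero _ _ ha hb (by rw [hWab]; exact hne)
    rw [hWab, rootMultiplicity_mul hne, rootMultiplicity_C, zero_add] at h2
    omega
  refine ⟨?_, ?_, ?_, ?_⟩
  · rcases wronskian_root_special_product_neg u v d hd c1 c2 c3 c4 c5 hxpos hWx with h | ⟨hz1, hz2⟩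
    · exact h
    · exfalso
      refine nocommon (v 1) (-(u 1)) (v 2) (-(u 2)) ?_ ?_ ?_
      · have : v 1 * -u 2 - -u 1 * v 2 = u 1 * v 2 - u 2 * v 1 := by ring
        rw [this]; exact h12
      · rw [special_member_eq]; exact hz1
      · rw [special_member_eq]; exact hz2
  · rcases wronskian_root_special_product23_neg u v d hd c1 c2 c3 c4 c5 hxpos hWx with h | ⟨hz1, hz2⟩
    · exact h
    · exfalso
      refine nocommon (v 2) (-(u 2)) (v 3) (-(u 3)) ?_ ?_ ?_
      · have : v 2 * -u 3 - -u 2 * v 3 = u 2 * v 3 - u 3 * v 2 := by ring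
        rw [this]; exact hne23
      · rw [special_member_eq]; exact hz1
      · rw [special_member_eq]; exact hz2
  · rcases wronskian_root_special_product13_pos u v d hd c1 c2 c3 c4 c5 hxpos hWx with h | ⟨hz1, hz2⟩
    · exact h
    · exfalso
      refine nocommon (v 1) (-(u 1)) (v 3) (-(u 3)) ?_ ?_ ?_
      · have : v 1 * -u 3 - -u 1 * v 3 = u 1 * v 3 - u 3 * v 1 := by ring
        rw [this]; exact hne13
      · rw [special_member_eq]; exact hz1
      · rw [special_member_eq]; exact hz2
  · have := derivative_wronskian_eval_ne_zero_of_five_le u v d hd hA h5 hx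
    rw [← hWdef] at this
    exact this

end WronskianDevelopable

end Summit.ValiantsHypothesis.ValiantsHypothesis.Theorems.KPlusLogSqLaw.TowerGraft
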